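import Mathlib
import Summits.Ventures.PercRepro2.TwoHullMasterBlocks
import Summits.Ventures.PercRepro2.SwCheck

/-!
# A kernel-checked certificate for (MM) on an explicit graph: cube covers by bitmask (blind cell
PercRepro2, night-4 g40, 2026-08-29; proofs/NIGHT4-G40.md §2)

On the edge-list graphs of `SwCheckMask` (configurations as bitmasks, clusters by `clusterMask`),
a CUBE COVER is given as a list of blocks `(base, classes)`: the points of a block are
`base ⊕ (XOR of the classes selected by a subset mask s < 2^d)` (`ptMask`).  The checker
`checkCover n es l h blocks` verifies: every point of every block lies in `U = {h ∉ H_l}`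
(`inU`); along every block the hull pair of `l` is monotone and the hull pair of `h` antitone in
the subset order of the cube (`pairLE`, bitmask inclusions on the low `n` bits); the antipode
`s ↦ (2^d − 1) ⊕ s` mirrors the hull pair of `l` or the hull pair of `h` (`mirrorEq`); the points
of all blocks are pairwise distinct and every `U`-configuration below `2^m` is a point of some
block.  **`twoHullMaster_of_checkCover`**: a certificate accepted by the checker gives
`TwoHullMaster (endsOf es) l h` through the cube-block principle `twoHullMaster_of_cubeCover`; on a
concrete graph the certificate is checked by `decide +kernel` — standard axioms only
(TwoHullMasterPrism.lean).
-/

namespace Summit.Ventures.PercRepro2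

namespace BlockCheck

open Hull LocRows Path2 Glue2 Blocks SwCheck

variable {n : ℕ}

/-! ## §1 The points of a block -/

/-- The XOR of the classes `cls` whose index (from `j` on) is a set bit of `s`. -/
def selXor : List ℕ → ℕ → ℕ → ℕ
  | [], _, _ => 0
  | c :: cs, s, j => (if s.testBit j then c else 0) ^^^ selXor cs s (j + 1)

/-- The point of the block `(base, cls)` at the subset mask `s`. -/
def ptMask (base : ℕ) (cls : List ℕ) (s : ℕ) : ℕ := base ^^^ selXor cls s 0

/-- `selXor` stays below `2^m` when the classes do. -/
lemma selXor_lt {m : ℕ} : ∀ (cls : List ℕ) (s j : ℕ), (∀ c ∈ cls, c < 2 ^ m) →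
    selXor cls s j < 2 ^ m
  | [], _, _, _ => by simp [selXor]
  | c :: cs, s, j, hc => by
    simp only [selXor]
    apply Nat.xor_lt_two_pow
    · split_ifs
      · exact hc c List.mem_cons_self
      · exact Nat.two_pow_pos m
    · exact selXor_lt cs s (j + 1) fun c' hc' => hc c' (List.mem_cons_of_mem _ hc')

/-- The points of a block stay below `2^m`. -/
lemma ptMask_lt {m base : ℕ} {cls : List ℕ} (hb : base < 2 ^ m) (hc : ∀ c ∈ cls, c < 2 ^ m)
    (s : ℕ) : ptMask base cls s < 2 ^ m :=
  Nat.xor_lt_two_pow hb (selXor_lt cls s 0 hc)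

/-- `selXor` depends on `s` only through the bits `j, j+1, …, j + length − 1`. -/
lemma selXor_congr : ∀ (cls : List ℕ) (s s' j : ℕ),
    (∀ i, j ≤ i → i < j + cls.length → s.testBit i = s'.testBit i) →
      selXor cls s j = selXor cls s' j
  | [], _, _, _, _ => rfl
  | c :: cs, s, s', j, hss' => by
    simp only [selXor]
    rw [hss' j le_rfl (by simp), selXor_congr cs s s' (j + 1)
      fun i hi hi' => hss' i (by omega) (by simp at hi' ⊢; omega)]

/-! ## §2 Bitmasks and configurations -/

/-- `toConfig` is injective below `2^m`. -/
lemma toConfig_inj {m ω ω' : ℕ} (hω : ω < 2 ^ m) (hω' : ω' < 2 ^ m)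
    (h : toConfig m ω = toConfig m ω') : ω = ω' := by
  apply Nat.eq_of_testBit_eq
  intro i
  by_cases hi : i < m
  · exact congrFun h ⟨i, hi⟩
  · rw [Nat.testBit_lt_two_pow (lt_of_lt_of_le hω (Nat.pow_le_pow_right (by omega) (by omega))),
      Nat.testBit_lt_two_pow (lt_of_lt_of_le hω' (Nat.pow_le_pow_right (by omega) (by omega)))]

/-- The bitmask of a cube point (a choice below `2^d`). -/
noncomputable def encode {d : ℕ} (ε : Fin d → Bool) : ℕ := (exists_toConfig_eq d ε).choose

/-- The encoding is below `2^d` and decodes to the point. -/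
lemma encode_spec {d : ℕ} (ε : Fin d → Bool) : encode ε < 2 ^ d ∧ toConfig d (encode ε) = ε :=
  (exists_toConfig_eq d ε).choose_spec

/-- The bits of the encoding are the point. -/
lemma testBit_encode {d : ℕ} (ε : Fin d → Bool) (j : Fin d) : (encode ε).testBit j.val = ε j :=
  congrFun (encode_spec ε).2 j

/-- The subset order of the cube is the bitwise order of the encodings. -/
lemma land_encode_of_le {d : ℕ} {ε ε' : Fin d → Bool} (hle : ε ≤ ε') :
    encode ε &&& encode ε' = encode ε := by
  apply Nat.eq_of_testBit_eq
  intro i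
  rw [Nat.testBit_land]
  by_cases hi : i < d
  · have h1 := testBit_encode ε ⟨i, hi⟩
    have h2 := testBit_encode ε' ⟨i, hi⟩
    simp only at h1 h2
    rw [h1, h2]
    have := hle ⟨i, hi⟩
    revert this
    cases ε ⟨i, hi⟩ <;> cases ε' ⟨i, hi⟩ <;> simp
  · rw [Nat.testBit_lt_two_pow
      (lt_of_lt_of_le (encode_spec ε).1 (Nat.pow_le_pow_right (by omega) (by omega)))]
    simp

/-- The antipode of the cube is the complement mask. -/
lemma encode_cubeNot {d : ℕ} (ε : Fin d → Bool) : encode (cubeNot ε) = blueMask d (encode ε) := by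
  have h1 : toConfig d (blueMask d (encode ε)) = cubeNot ε := by
    rw [toConfig_blueMask, (encode_spec ε).2]
    rfl
  have hlt : blueMask d (encode ε) < 2 ^ d :=
    Nat.xor_lt_two_pow (Nat.sub_lt (Nat.two_pow_pos d) (by norm_num)) (encode_spec ε).1
  exact toConfig_inj (encode_spec (cubeNot ε)).1 hlt ((encode_spec (cubeNot ε)).2.trans h1.symm)

/-! ## §3 The checks -/

/-- The red cluster mask of `v`. -/
def rMask (es : List (Fin n × Fin n)) (ω : ℕ) (v : Fin n) : ℕ := clusterMask ω es v

/-- The blue cluster mask of `v`. -/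
def bMask (es : List (Fin n × Fin n)) (ω : ℕ) (v : Fin n) : ℕ :=
  clusterMask (blueMask es.length ω) es v

/-- Membership in `U = {h ∉ H_l}`. -/
def inU (es : List (Fin n × Fin n)) (l h : Fin n) (ω : ℕ) : Bool :=
  !(rMask es ω l).testBit h.val && !(bMask es ω l).testBit h.val

/-- `a ⊆ b` on the low `n` bits. -/
def subMask (n a b : ℕ) : Bool := (a &&& ((2 ^ n - 1) ^^^ b)) == 0

/-- The hull pair of `v` at `ω` lies below the one at `ω'`. -/
def pairLE (es : List (Fin n × Fin n)) (ω ω' : ℕ) (v : Fin n) : Bool :=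
  subMask n (rMask es ω v) (rMask es ω' v) && subMask n (bMask es ω' v) (bMask es ω v)

/-- The hull pair of `v` at `ω'` is the swap of the one at `ω`. -/
def mirrorEq (es : List (Fin n × Fin n)) (ω ω' : ℕ) (v : Fin n) : Bool :=
  (rMask es ω' v == bMask es ω v) && (bMask es ω' v == rMask es ω v)

/-- The checks on one block: classes below `2^m`, points in `U`, monotone along the cube, mirrored
at the antipode. -/
def checkBlock (es : List (Fin n × Fin n)) (l h : Fin n) (b : ℕ × List ℕ) : Bool :=
  decide (b.1 < 2 ^ es.length) && b.2.all (fun c => decide (c < 2 ^ es.length)) &&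
  (List.range (2 ^ b.2.length)).all (fun s => inU es l h (ptMask b.1 b.2 s)) &&
  (List.range (2 ^ b.2.length)).all (fun s => (List.range (2 ^ b.2.length)).all (fun s' =>
    !((s &&& s') == s) ||
      (pairLE es (ptMask b.1 b.2 s) (ptMask b.1 b.2 s') l &&
        pairLE es (ptMask b.1 b.2 s') (ptMask b.1 b.2 s) h))) &&
  ((List.range (2 ^ b.2.length)).all (fun s =>
      mirrorEq es (ptMask b.1 b.2 s) (ptMask b.1 b.2 (blueMask b.2.length s)) l) ||
    (List.range (2 ^ b.2.length)).all (fun s =>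
      mirrorEq es (ptMask b.1 b.2 s) (ptMask b.1 b.2 (blueMask b.2.length s)) h))

/-- **The checker**: every block passes, every `U`-configuration is a point of some block, and the
points of all blocks are pairwise distinct. -/
def checkCover (es : List (Fin n × Fin n)) (l h : Fin n) (blocks : List (ℕ × List ℕ)) : Bool :=
  blocks.all (checkBlock es l h) &&
  (List.range (2 ^ es.length)).all (fun ω => !inU es l h ω ||
    blocks.any (fun b => (List.range (2 ^ b.2.length)).any (fun s => ptMask b.1 b.2 s == ω))) &&
  (List.range blocks.length).all (fun i => (List.range blocks.length).all (fun i' =>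
    (List.range (2 ^ (blocks.getD i (0, [])).2.length)).all (fun s =>
      (List.range (2 ^ (blocks.getD i' (0, [])).2.length)).all (fun s' =>
        (decide (i = i') && decide (s = s')) ||
          !(ptMask (blocks.getD i (0, [])).1 (blocks.getD i (0, [])).2 s ==
            ptMask (blocks.getD i' (0, [])).1 (blocks.getD i' (0, [])).2 s')))))

/-! ## §4 What the checks guarantee -/

/-- The red mask is the red cluster. -/
lemma rMask_testBit_iff (es : List (Fin n × Fin n)) (ω : ℕ) (v x : Fin n) :
    (rMask es ω v).testBit x.val = true ↔ x ∈ cluster (endsOf es) (toConfig es.length ω) v :=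
  clusterMask_testBit_iff ω es v x

/-- The blue mask is the blue cluster. -/
lemma bMask_testBit_iff (es : List (Fin n × Fin n)) (ω : ℕ) (v x : Fin n) :
    (bMask es ω v).testBit x.val = true ↔
      x ∈ cluster (endsOf es) (blue (toConfig es.length ω)) v := by
  rw [bMask, clusterMask_testBit_iff, toConfig_blueMask]

/-- `inU` decides `h ∉ H_l`. -/
lemma inU_iff (es : List (Fin n × Fin n)) (l h : Fin n) (ω : ℕ) :
    inU es l h ω = true ↔ h ∉ hull (endsOf es) (toConfig es.length ω) l := by
  simp only [inU, Bool.and_eq_true, Bool.not_eq_true']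
  rw [mem_hull_iff, not_or, ← rMask_testBit_iff, ← bMask_testBit_iff]
  simp

/-- `subMask` is inclusion on the low bits. -/
lemma subMask_spec {a b : ℕ} (hs : subMask n a b = true) (x : Fin n)
    (hx : a.testBit x.val = true) : b.testBit x.val = true := by
  simp only [subMask, beq_iff_eq] at hs
  have hbit := congrArg (fun S => S.testBit x.val) hs
  simp only [Nat.testBit_land, Nat.testBit_xor, Nat.testBit_two_pow_sub_one, x.isLt,
    decide_true, Nat.zero_testBit, hx, Bool.true_and, Bool.true_xor] at hbit
  simpa using hbit

/-- `pairLE` gives the pair order of the hull pairs. -/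
lemma pairLE_spec (es : List (Fin n × Fin n)) {ω ω' : ℕ} {v : Fin n}
    (hp : pairLE es ω ω' v = true) :
    PairLE (hullPair (endsOf es) (toConfig es.length ω) v)
      (hullPair (endsOf es) (toConfig es.length ω') v) := by
  simp only [pairLE, Bool.and_eq_true] at hp
  refine ⟨fun x hx => ?_, fun x hx => ?_⟩
  · rw [hullPair] at hx ⊢
    rw [← rMask_testBit_iff] at hx ⊢
    exact subMask_spec hp.1 x hx
  · rw [hullPair] at hx ⊢
    rw [← bMask_testBit_iff] at hx ⊢
    exact subMask_spec hp.2 x hx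

/-- `mirrorEq` gives the swapped hull pair. -/
lemma mirrorEq_spec (es : List (Fin n × Fin n)) {ω ω' : ℕ} {v : Fin n}
    (hm : mirrorEq es ω ω' v = true) :
    hullPair (endsOf es) (toConfig es.length ω') v =
      (hullPair (endsOf es) (toConfig es.length ω) v).swap := by
  simp only [mirrorEq, Bool.and_eq_true, beq_iff_eq] at hm
  simp only [hullPair, Prod.swap]
  refine Prod.ext ?_ ?_
  · ext x
    rw [← rMask_testBit_iff, ← bMask_testBit_iff, hm.1]
  · ext x
    rw [← bMask_testBit_iff, ← rMask_testBit_iff, hm.2]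

/-! ## §5 The cover -/

variable (es : List (Fin n × Fin n)) (l h : Fin n) (blocks : List (ℕ × List ℕ))

/-- The cube point of a block as a configuration. -/
noncomputable def pt (b : Fin blocks.length) (ε : Fin (blocks.get b).2.length → Bool) :
    Config (Fin es.length) :=
  toConfig es.length (ptMask (blocks.get b).1 (blocks.get b).2 (encode ε))

/-- `getD` at a valid index is `get`. -/
lemma getD_eq_get (b : Fin blocks.length) : blocks.getD b.val (0, []) = blocks.get b := by
  rw [List.getD_eq_getElem _ _ b.isLt]
  simp

/-- A block accepted by `checkBlock` whose points are pairwise distinct is a monotone cube block. -/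
lemma cubeBlock_of_checkBlock (b : Fin blocks.length)
    (hb : checkBlock es l h (blocks.get b) = true)
    (hdist : ∀ s, s < 2 ^ (blocks.get b).2.length → ∀ s', s' < 2 ^ (blocks.get b).2.length →
      s ≠ s' → ptMask (blocks.get b).1 (blocks.get b).2 s ≠ ptMask (blocks.get b).1 (blocks.get b).2 s') :
    CubeBlock (endsOf es) l h (pt es blocks b) := by
  simp only [checkBlock, Bool.and_eq_true, decide_eq_true_eq, List.all_eq_true, List.mem_range,
    Bool.or_eq_true, Bool.not_eq_true'] at hb
  obtain ⟨⟨⟨⟨hbase, hcls⟩, hmem⟩, hmono⟩, hmirror⟩ := hb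
  have hlt : ∀ s, ptMask (blocks.get b).1 (blocks.get b).2 s < 2 ^ es.length :=
    fun s => ptMask_lt hbase (fun c hc => hcls c hc) s
  refine ⟨?_, ?_, ?_, ?_, ?_⟩
  · intro ε ε' hεε'
    have h1 := toConfig_inj (hlt _) (hlt _) hεε'
    have h2 : encode ε = encode ε' := by
      by_contra hne
      exact hdist _ (encode_spec ε).1 _ (encode_spec ε').1 hne h1
    rw [← (encode_spec ε).2, ← (encode_spec ε').2, h2]
  · intro ε
    exact (inU_iff es l h _).1 (hmem _ (encode_spec ε).1)
  · intro ε ε' hle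
    have := (hmono _ (encode_spec ε).1 _ (encode_spec ε').1).resolve_left
      (by simp [land_encode_of_le hle])
    exact pairLE_spec es this.1
  · intro ε ε' hle
    have := (hmono _ (encode_spec ε).1 _ (encode_spec ε').1).resolve_left
      (by simp [land_encode_of_le hle])
    exact pairLE_spec es this.2
  · rcases hmirror with hm | hm
    · left
      intro ε
      have := mirrorEq_spec es (hm _ (encode_spec ε).1)
      simp only [pt, encode_cubeNot]
      exact this
    · right
      intro ε
      have := mirrorEq_spec es (hm _ (encode_spec ε).1)
      simp only [pt, encode_cubeNot]
      exact this

/-- The encoding of a decoded mask is the mask. -/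
lemma encode_toConfig {d s : ℕ} (hs : s < 2 ^ d) : encode (toConfig d s) = s :=
  toConfig_inj (encode_spec (toConfig d s)).1 hs (encode_spec (toConfig d s)).2

/-- **(MM) from a certificate**: a cover accepted by `checkCover` gives (MM) on the graph. -/
theorem twoHullMaster_of_checkCover (hc : checkCover es l h blocks = true) :
    TwoHullMaster (endsOf es) l h := by
  simp only [checkCover, Bool.and_eq_true, List.all_eq_true, List.mem_range, Bool.or_eq_true,
    Bool.not_eq_true', List.any_eq_true, beq_iff_eq, beq_eq_false_iff_ne, decide_eq_true_eq] at hc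
  obtain ⟨⟨hblocks, hcover⟩, hdist⟩ := hc
  have hdist' : ∀ (b b' : Fin blocks.length) (s s' : ℕ), s < 2 ^ (blocks.get b).2.length →
      s' < 2 ^ (blocks.get b').2.length →
      ptMask (blocks.get b).1 (blocks.get b).2 s = ptMask (blocks.get b').1 (blocks.get b').2 s' →
      b = b' ∧ s = s' := by
    intro b b' s s' hs hs' heq
    have := hdist b.val b.isLt b'.val b'.isLt s (by rwa [getD_eq_get]) s' (by rwa [getD_eq_get])
    rw [getD_eq_get, getD_eq_get] at this
    rcases this with ⟨hbb', hss'⟩ | hne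
    · exact ⟨Fin.ext hbb', hss'⟩
    · exact absurd heq hne
  refine twoHullMaster_of_cubeCover (β := Fin blocks.length)
    (ιb := fun b => Fin (blocks.get b).2.length) (ptb := pt es blocks) ⟨?_, ?_, ?_⟩
  · intro b
    refine cubeBlock_of_checkBlock es l h blocks b (hblocks _ (List.get_mem _ _)) ?_
    intro s hs s' hs' hne heq
    exact hne (hdist' b b s s' hs hs' heq).2
  · intro ζ hζ
    obtain ⟨ω, hω, rfl⟩ := exists_toConfig_eq es.length ζ
    have hU : inU es l h ω = true := (inU_iff es l h ω).2 hζ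
    obtain ⟨bl, hbl, s, hs, hps⟩ := (hcover ω hω).resolve_left (by simp [hU])
    obtain ⟨b, rfl⟩ := List.mem_iff_get.1 hbl
    refine ⟨b, toConfig _ s, ?_⟩
    simp only [pt, encode_toConfig hs, hps]
  · intro b b' ε ε' heq
    have hlt : ∀ (b : Fin blocks.length) s,
        ptMask (blocks.get b).1 (blocks.get b).2 s < 2 ^ es.length := by
      intro b s
      have hb := hblocks _ (List.get_mem blocks b)
      simp only [checkBlock, Bool.and_eq_true, decide_eq_true_eq, List.all_eq_true] at hb
      exact ptMask_lt hb.1.1.1.1 (fun c hc => hb.1.1.1.2 c hc) s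
    have h1 := toConfig_inj (hlt b _) (hlt b' _) heq
    exact (hdist' b b' _ _ (encode_spec ε).1 (encode_spec ε').1 h1).1

end BlockCheck

end Summit.Ventures.PercRepro2
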